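import Summits.AtomisticToContinuum.Crystallization.Theorems.ChessboardParticlePlanesLjPlaneChessboardMatrixLatticeForm

/-!
# Crux `ChessboardParticlePlanes.LjPlaneChessboard` (stmt-AtomisticToContinuum-6709), line `Sketch`,
# stub `matrixLatticeFormNonneg_finset` — finset adapter of the matrix Poisson positivity

Let `V` be a `2`-dimensional real inner-product space, `L ⊂ V` a full lattice with dual lattice
`L* = dualLattice L`, and `k_{jj'} : V → ℂ` (`j, j' < N`) continuous kernels with
`‖k_{jj'}(x)‖ ≤ C (1 + ‖x‖)⁻³` and `𝓕k_{jj'}` summable over `L*`, such that for every `w ∈ V` the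
matrix `(𝓕k_{jj'}(w))_{jj'}` is Hermitian positive semi-definite.  Then for all finite point sets
`P_j ⊂ V` (`j < N`) the periodised form
`∑_{j,j'} ∑_{x ∈ P_j} ∑_{y ∈ P_{j'}} ∑_{l ∈ L} k_{jj'}(x - y + l)` is real and `≥ 0`.

Proof.  This is the landed weighted version `matrixLatticeFormNonneg` (point families
`p_{ja} ∈ V`, weights `s_{ja} ∈ ℂ`, `a < M`) at unit weights: with `M = max_j #P_j`, enumerate
`P_j = {e_j(0), …, e_j(#P_j - 1)}` (`e_j = (P_j).equivFin.symm`), put `p_{ja} = e_j(a)`,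
`s_{ja} = 1` for `a < #P_j` and `p_{ja} = 0`, `s_{ja} = 0` for `#P_j ≤ a < M`; the padded terms
vanish and the remaining ones are a re-indexing of `P_j × P_{j'}`
(`matrixLatticeFormFinset_sum_pad`, `matrixLatticeFormFinset_reindex`).
[folklore]
-/

noncomputable section

namespace Summit.AtomisticToContinuum.Crystallization.Theorems.ChessboardParticlePlanesLjPlaneChessboard

open Literature.Algebra.EuclideanLattices
open scoped Real InnerProductSpace FourierTransform ComplexConjugate

section Reindex

variable {V : Type*} [AddCommGroup V]

/-- **Padded enumeration of a finset sum**: for `#P ≤ M` and the enumeration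
`e = P.equivFin.symm : Fin #P ≃ P`, padded by the point `0` with weight `0` beyond `#P`,
`∑_{a < M} s_a g(p_a) = ∑_{x ∈ P} g(x)` where `p_a = e(a)`, `s_a = 1` for `a < #P`. [folklore] -/
theorem matrixLatticeFormFinset_sum_pad (P : Finset V) {M : ℕ} (hM : P.card ≤ M) (g : V → ℂ) :
    ∑ a : Fin M, (if (a : ℕ) < P.card then (1 : ℂ) else 0) *
        g (if h : (a : ℕ) < P.card then ((P.equivFin.symm ⟨a, h⟩ : P) : V) else 0) =
      ∑ x ∈ P, g x := by
  rw [Fin.sum_univ_eq_sum_range (fun n : ℕ => (if n < P.card then (1 : ℂ) else 0) *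
      g (if h : n < P.card then ((P.equivFin.symm ⟨n, h⟩ : P) : V) else 0)) M,
    ← Finset.sum_subset (Finset.range_subset_range.2 hM), ← Fin.sum_univ_eq_sum_range,
    ← Finset.sum_coe_sort P, ← P.equivFin.symm.sum_comp]
  · refine Fintype.sum_congr _ _ fun i => ?_
    simp only [if_pos i.isLt, dif_pos i.isLt, Fin.eta, one_mul]
  · intro n _ hn
    rw [Finset.mem_range] at hn
    simp only [if_neg hn, zero_mul]

/-- **Re-indexing the double sum**: for `#P, #Q ≤ M` and the padded enumerations `(p_a, s_a)` of
`P` and `(q_b, t_b)` of `Q` (as in `matrixLatticeFormFinset_sum_pad`),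
`∑_{a,b < M} conj(s_a) t_b T(p_a - q_b) = ∑_{x ∈ P, y ∈ Q} T(x - y)`. [folklore] -/
theorem matrixLatticeFormFinset_reindex (P Q : Finset V) {M : ℕ} (hP : P.card ≤ M)
    (hQ : Q.card ≤ M) (T : V → ℂ) :
    ∑ a : Fin M, ∑ b : Fin M, conj (if (a : ℕ) < P.card then (1 : ℂ) else 0) *
        (if (b : ℕ) < Q.card then (1 : ℂ) else 0) *
          T ((if h : (a : ℕ) < P.card then ((P.equivFin.symm ⟨a, h⟩ : P) : V) else 0) -
            (if h : (b : ℕ) < Q.card then ((Q.equivFin.symm ⟨b, h⟩ : Q) : V) else 0)) =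
      ∑ x ∈ P, ∑ y ∈ Q, T (x - y) := by
  -- the weights are real
  have hconj : ∀ a : Fin M, conj (if (a : ℕ) < P.card then (1 : ℂ) else 0) =
      if (a : ℕ) < P.card then (1 : ℂ) else 0 := by
    intro a
    split_ifs
    · exact map_one _
    · exact map_zero _
  -- the inner sum over `b`
  have inner : ∀ a : Fin M, ∑ b : Fin M, conj (if (a : ℕ) < P.card then (1 : ℂ) else 0) *
      (if (b : ℕ) < Q.card then (1 : ℂ) else 0) *
        T ((if h : (a : ℕ) < P.card then ((P.equivFin.symm ⟨a, h⟩ : P) : V) else 0) -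
          (if h : (b : ℕ) < Q.card then ((Q.equivFin.symm ⟨b, h⟩ : Q) : V) else 0)) =
      (if (a : ℕ) < P.card then (1 : ℂ) else 0) * ∑ y ∈ Q,
        T ((if h : (a : ℕ) < P.card then ((P.equivFin.symm ⟨a, h⟩ : P) : V) else 0) - y) := by
    intro a
    rw [hconj, ← matrixLatticeFormFinset_sum_pad Q hQ fun y =>
        T ((if h : (a : ℕ) < P.card then ((P.equivFin.symm ⟨a, h⟩ : P) : V) else 0) - y),
      Finset.mul_sum]
    exact Finset.sum_congr rfl fun b _ => mul_assoc _ _ _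
  simp_rw [inner]
  -- the outer sum over `a`
  exact matrixLatticeFormFinset_sum_pad P hP fun x => ∑ y ∈ Q, T (x - y)

end Reindex

/-- **Finset adapter of the matrix Poisson positivity** (stub `matrixLatticeFormNonneg_finset` of
line `Sketch`): for a full lattice `L` in a `2`-dimensional real inner-product space `V` and
continuous kernels `k_{jj'} : V → ℂ` with `‖k_{jj'}(x)‖ ≤ C (1 + ‖x‖)⁻³`, `𝓕k_{jj'}` summable over
`L*` and `(𝓕k_{jj'}(w))_{jj'}` Hermitian positive semi-definite for every `w`, every family of
finite point sets `P_j ⊂ V` satisfies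
`∑_{j,j'} ∑_{x ∈ P_j, y ∈ P_{j'}} ∑_{l ∈ L} k_{jj'}(x - y + l) ∈ [0, ∞)`: the weighted version
`matrixLatticeFormNonneg` at the padded enumerations of the `P_j` with unit weights
(`matrixLatticeFormFinset_reindex`). [folklore] -/
theorem matrixLatticeFormNonneg_finset :
    ∀ (V : Type) [NormedAddCommGroup V] [InnerProductSpace ℝ V] [FiniteDimensional ℝ V]
      [MeasurableSpace V] [BorelSpace V] (L : Submodule ℤ V) [DiscreteTopology L] [IsZLattice ℝ L]
      (N : ℕ) (k : Fin N → Fin N → V → ℂ) (C : ℝ) (P : Fin N → Finset V), Module.finrank ℝ V = 2 →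
      (∀ j j', Continuous (k j j')) →
      (∀ j j' (x : V), ‖k j j' x‖ ≤ C * (1 + ‖x‖) ^ (-(3 : ℝ))) →
      (∀ j j', Summable (fun w : dualLattice L => 𝓕 (k j j') (w : V))) →
      (∀ (w : V) (c : Fin N → ℂ),
        0 ≤ (∑ j, ∑ j', (starRingEnd ℂ) (c j) * 𝓕 (k j j') w * c j').re ∧
        (∑ j, ∑ j', (starRingEnd ℂ) (c j) * 𝓕 (k j j') w * c j').im = 0) →
      0 ≤ (∑ j, ∑ j', ∑ x ∈ P j, ∑ y ∈ P j', ∑' l : L, k j j' (x - y + (l : V))).re ∧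
      (∑ j, ∑ j', ∑ x ∈ P j, ∑ y ∈ P j', ∑' l : L, k j j' (x - y + (l : V))).im = 0 := by
  intro V _ _ _ _ _ L _ _ N k C P hV hk hdec hsum hA
  -- a common bound `M` for the cardinalities `#P_j`
  obtain ⟨M, hM⟩ : ∃ M : ℕ, ∀ j : Fin N, (P j).card ≤ M :=
    ⟨Finset.univ.sup fun j => (P j).card, fun j =>
      Finset.le_sup (f := fun j => (P j).card) (Finset.mem_univ j)⟩
  -- the finset form is the weighted form at the padded enumerations
  have key : ∀ j j' : Fin N,
      ∑ x ∈ P j, ∑ y ∈ P j', ∑' l : L, k j j' (x - y + (l : V)) =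
        ∑ a : Fin M, ∑ b : Fin M, conj (if (a : ℕ) < (P j).card then (1 : ℂ) else 0) *
          (if (b : ℕ) < (P j').card then (1 : ℂ) else 0) *
            ∑' l : L, k j j'
              ((if h : (a : ℕ) < (P j).card then (((P j).equivFin.symm ⟨a, h⟩ : P j) : V) else 0) -
                (if h : (b : ℕ) < (P j').card then (((P j').equivFin.symm ⟨b, h⟩ : P j') : V)
                  else 0) + (l : V)) := fun j j' =>
    (matrixLatticeFormFinset_reindex (P j) (P j') (hM j) (hM j')
      fun z => ∑' l : L, k j j' (z + (l : V))).symm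
  have hform : ∑ j, ∑ j', ∑ x ∈ P j, ∑ y ∈ P j', ∑' l : L, k j j' (x - y + (l : V)) =
      ∑ j, ∑ j', ∑ a : Fin M, ∑ b : Fin M, conj (if (a : ℕ) < (P j).card then (1 : ℂ) else 0) *
        (if (b : ℕ) < (P j').card then (1 : ℂ) else 0) *
          ∑' l : L, k j j'
            ((if h : (a : ℕ) < (P j).card then (((P j).equivFin.symm ⟨a, h⟩ : P j) : V) else 0) -
              (if h : (b : ℕ) < (P j').card then (((P j').equivFin.symm ⟨b, h⟩ : P j') : V)
                else 0) + (l : V)) :=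
    Finset.sum_congr rfl fun j _ => Finset.sum_congr rfl fun j' _ => key j j'
  rw [hform]
  exact matrixLatticeFormNonneg V L N k C hV hk hdec hsum hA M
    (fun j a => if h : (a : ℕ) < (P j).card then (((P j).equivFin.symm ⟨a, h⟩ : P j) : V) else 0)
    fun j a => if (a : ℕ) < (P j).card then (1 : ℂ) else 0

end Summit.AtomisticToContinuum.Crystallization.Theorems.ChessboardParticlePlanesLjPlaneChessboard

end
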